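import Summits.BirchSwinnertonDyer.BirchSwinnertonDyer.Theorems.ByReductionTypeAtTwoFineSelmerConjAAtTwoAdditivePotGoodCapitulationCertificate
import Summits.BirchSwinnertonDyer.BirchSwinnertonDyer.Theorems.ByReductionTypeAtTwoFineSelmerConjAAtTwoAdditivePotGoodCapitulationDoorTwoPrimes
import Summits.BirchSwinnertonDyer.BirchSwinnertonDyer.Theorems.ByReductionTypeAtTwoFineSelmerConjAAtTwoAdditivePotGoodFukudaRowStampsF
import HarnessLib

/-!
# Route `ByReductionTypeAtTwo` (rung K4), crux C1″ `FineSelmerConjAAtTwoAdditivePotGood` (item stmt-BirchSwinnertonDyer-22615):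
# CAPITULATION CERTIFICATE for the census row `460944bn1` (cubic `2`-torsion point field of discriminant `-115236`, EVEN class number):
# the displayed hypothesis `e₁ = e₀` of `conjA_two_460944bn1_of_fukudaLayers` DISCHARGED — (A)₂ for `460944bn1` modulo `hLim2` ALONE
# (a `--supports 22615` file; seat `bsd-2adic-k4-w1` GEN 7; consumer of `…CapitulationCertificate` and `…ClassGroupCyclicCriterion`)

HONEST FRAMING (cell `bsd-2adic`, D-0036/D-0054/D-0152): a per-class stamp, conditional on `hLim2` (Lim 2017 Thm. 3.5 at `2`) BY NAME and on
nothing else; the former displayed numeric equality `ord₂ h(ℚ(θ, √2)) = ord₂ h(ℚ(θ))` (census/PARI) is now KERNEL. Closes nothing at the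
`∀`-level; nothing booked; BSD is not proved by any of this.

THE CERTIFICATE (`K = ℚ(θ)`, `θ³ + (-3)θ² + (0)θ + (-194) = 0`, `K₁ = K(s)`, `s² = 2`):
* K-SIDE (`zpowers_mk0_eq_top_d115236n`): `Cl(K) = ⟨[𝔮]⟩` for `𝔮 = (23, θ − 10)` by a pair-witness Minkowski sweep (`…ClassGroupCyclicCriterion`),
  hence `h_K = ord [𝔮]` — no class number is computed;
* L-SIDE (`capitulationIdentity_d115236n`): in ANY commutative ring with `g(B) = 0`, `S² = 2, together with Ω = ω = (1 + 2B + B²)/3 (the second generator of 𝓞 K, index 3) and the half-integral W = −(B+B²)S/2 of 𝓞 K₁`, the identity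
  `(y) · (23, B − 10, s + 5) = (23) · (23, B − 10, s − 5)` for the explicit `y` below (six generator memberships, each a
  `linear_combination`; found by lattice reduction in `𝓞 K₁`), so the class of `I = (23, θ − 10, s − 5)` — a prime of `K₁` above `𝔮` — is
  `Gal(K₁/K)`-fixed with `N[I] = [𝔮]` (`…CapitulationCertificate`);
* `classNumberPExp_one_eq_zero_layer_d115236n`: the door with TWO primes above `2` (`2 = 𝔭²𝔮`, `4 ∤ g(0)`, `4 ∤ g(3)`) `classNumberPExp_one_eq_classNumberPExp_zero_of_ambiguous_of_nonNorm_unit` (`…CapitulationDoorTwoPrimes`) with the fundamental unit `ε = (290964739325664831989 + 41680179161988774559θ + 10470065944049864735θ²)/3` (`N ε = 1`, `ε ↦ 5 (mod 8)` under `θ ↦ z ≡ 5`: not a norm from `K(√2)`).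

References: [Fukuda1994] Thm. 1 (1); [Lim2017FineSelmer] Thm. 3.5, Lemma 3.2; [Lang1990] Ch. 13 §4 Lemma 4.1; [Gras2003] II.6.2;
[Marcus1977] Ch. 5 Thm. 37; [Cohen1993] §6.5.
-/

set_option autoImplicit false
-- sibling precedent (`…FukudaRowStampsE.lean`): the directory name repeats the summit name
set_option linter.dupNamespace false

noncomputable section

open scoped Classical IntermediateField NumberField Real nonZeroDivisors

namespace Summit.BirchSwinnertonDyer.BirchSwinnertonDyer.Theorems.AddKatoTwo

open WeierstrassCurve Field Polynomial IsDedekindDomain NumberField Literature.NumberTheory.EllipticCurves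
  Literature.NumberTheory.GaloisRepresentations Literature.NumberTheory.IwasawaTheory Literature.NumberTheory.NumberFields
  Summit.BirchSwinnertonDyer.BirchSwinnertonDyer.Theses.ByReductionTypeAtTwo

/-! ## §1 K-side: `Cl(K) = ⟨[𝔮]⟩` -/

section KSide

variable (K : Type) [Field K] [NumberField K]

/-- `X³ + (-6)X² + (-255)X + (-1452)` (the cubic of the second generator `ω = (1 + 2θ + θ²)/3` of `𝓞 K`) is irreducible over `ℚ`
(no root mod `5`). -/
theorem irreducible_cubic_d115236n_aux2 : Irreducible (Cubic.toPoly ⟨1, ((-6 : ℤ) : ℚ), ((-255 : ℤ) : ℚ), ((-1452 : ℤ) : ℚ)⟩) :=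
  haveI : Fact (Nat.Prime 5) := ⟨by norm_num⟩
  irreducible_cubic_of_no_root_zmod 5 (by decide)

/-- **`Cl(K) = ⟨[𝔮]⟩`, `𝔮 = (23, θ − 10)`, for every cubic number field whose integers contain a root `θ` of
`X³ + (-3)X² + (0)X + (-194)`** (`|d_K| ≤ 115236`, `M_K < 97`): a pair-witness sweep over the primes `ℓ < 97` in the order
5, 13, 29, 31, 37, 41, 47, 53, 59, 61, 67, 71, 73, 79, 83, 89, 2, 3, 7, 11, 17, 19, 43 — for each root `a` of the cubic mod `ℓ` an element of `(ℓ, θ − a)` of norm `ℓ · m` with `m` supported on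
the primes treated before (listed in the proof). Consequently `h_K = ord [𝔮]` (no class number is computed). KERNEL.
[cite: Marcus1977, Ch. 5 Thm. 37 and the class-group computations after Cor. 2] [cite: Cohen1993, §6.5] -/
theorem zpowers_mk0_eq_top_d115236n (h3 : Module.finrank ℚ K = 3) (b : 𝓞 K)
    (hb : b ^ 3 + (-3 : ℤ) * b ^ 2 + (0 : ℤ) * b + (-194 : ℤ) = 0)
    (h0 : Ideal.span ({((23 : ℕ) : 𝓞 K), b - ((10 : ℕ) : 𝓞 K)} : Set (𝓞 K)) ∈ (Ideal (𝓞 K))⁰) :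
    Subgroup.zpowers (ClassGroup.mk0 ⟨_, h0⟩) = ⊤ := by
  have hirr := irreducible_cubic_d115236n
  -- `ω = (1 + 2θ + 1θ²)/3 ∈ 𝓞 K` witnesses `3 ∣ [𝓞 K : ℤ[θ]]`, so `3² · |d_K| ≤ |disc|`
  obtain ⟨ω, hω, -⟩ := exists_intElem_of_scaled_cubic K b (1) (2) (1) (m := 3) (by norm_num) (-6) (-255) (-1452)
    (by push_cast; linear_combination (((214 : ℤ) : 𝓞 K) + ((24 : ℤ) : 𝓞 K) * b + ((9 : ℤ) : 𝓞 K) * b ^ 2 + ((1 : ℤ) : 𝓞 K) * b ^ 3) * hb)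
  have hd : |NumberField.discr K| ≤ (115236 : ℕ) :=
    abs_discr_le_of_sq_mul_le K (k := 3) (by norm_num)
      (sq_mul_abs_discr_le_abs_cubic_discr K h3 b hirr hb (by norm_num) (1) (2) (1) ⟨ω, hω⟩ (by norm_num))
      (by simp only [Cubic.discr]; norm_num)
  have hM := minkowskiBound_lt_of_sqrt_le K h3 hd (s := 339.47) (B := 97)
    ((Real.sqrt_le_sqrt (by norm_num : ((115236 : ℕ) : ℝ) ≤ (339.47 : ℝ) ^ 2)).trans (Real.sqrt_sq (by norm_num)).le) (by norm_num)
  set H : Subgroup (ClassGroup (𝓞 K)) := Subgroup.zpowers (ClassGroup.mk0 ⟨_, h0⟩) with hH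
  have hq : ClassIn H (Ideal.span ({((23 : ℕ) : 𝓞 K), b - ((10 : ℕ) : 𝓞 K)} : Set (𝓞 K))) := classIn_zpowers_self K _ h0
  have hS0 := forall_prime_above_nil K H
  -- second generator `b₂ = (1 + 2θ + 1θ²)/3`, a root of `X³ + (-6)X² + (-255)X + (-1452)` (index prime to 3)
  obtain ⟨b₂, -, hb₂⟩ := exists_intElem_of_scaled_cubic K b (1) (2) (1) (m := 3) (by norm_num) (-6) (-255) (-1452)
    (by push_cast; linear_combination (((214 : ℤ) : 𝓞 K) + ((24 : ℤ) : 𝓞 K) * b + ((9 : ℤ) : 𝓞 K) * b ^ 2 + ((1 : ℤ) : 𝓞 K) * b ^ 3) * hb)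
  have hirr₂ := irreducible_cubic_d115236n_aux2
  -- `ℓ = 23`: roots [10], treated primes []
  have h_23 : ∀ P : Ideal (𝓞 K), P.IsPrime → P ≠ ⊥ → ((23 : ℕ) : 𝓞 K) ∈ P → ClassIn H P :=
    classIn_above_of_pairWitnesses K h3 b hirr hb (ℓ := 23) (by norm_num) (S := []) (by decide) hS0 (fun a ha hdvd => by
      interval_cases a <;> norm_num at hdvd
      · exact Or.inl ⟨by norm_num, hq⟩)
  have hS1 := forall_prime_above_cons K h_23 hS0
  -- `ℓ = 5`: roots [], treated primes [23]
  have h_5 : ∀ P : Ideal (𝓞 K), P.IsPrime → P ≠ ⊥ → ((5 : ℕ) : 𝓞 K) ∈ P → ClassIn H P :=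
    classIn_above_of_pairWitnesses K h3 b hirr hb (ℓ := 5) (by norm_num) (S := [23]) (by decide) hS1 (fun a ha hdvd => by
      interval_cases a <;> norm_num at hdvd)
  have hS2 := forall_prime_above_cons K h_5 hS1
  -- `ℓ = 13`: roots [], treated primes [5, 23]
  have h_13 : ∀ P : Ideal (𝓞 K), P.IsPrime → P ≠ ⊥ → ((13 : ℕ) : 𝓞 K) ∈ P → ClassIn H P :=
    classIn_above_of_pairWitnesses K h3 b hirr hb (ℓ := 13) (by norm_num) (S := [5, 23]) (by decide) hS2 (fun a ha hdvd => by
      interval_cases a <;> norm_num at hdvd)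
  have hS3 := forall_prime_above_cons K h_13 hS2
  -- `ℓ = 29`: roots [12], treated primes [13, 5, 23]
  have h_29 : ∀ P : Ideal (𝓞 K), P.IsPrime → P ≠ ⊥ → ((29 : ℕ) : 𝓞 K) ∈ P → ClassIn H P :=
    classIn_above_of_pairWitnesses K h3 b hirr hb (ℓ := 29) (by norm_num) (S := [13, 5, 23]) (by decide) hS3 (fun a ha hdvd => by
      interval_cases a <;> norm_num at hdvd
      · exact Or.inr ⟨3649, -307, -35, 3, 6436343, 5, [23], by norm_num, by norm_num,
          (exists_intElem_of_scaled_cubic K b (3649) (-307) (-35) (m := 3) (by norm_num) (-3237) (2582865) (186653947)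
            (by push_cast; linear_combination (((-47148338 : ℤ) : 𝓞 K) + ((-12152595 : ℤ) : 𝓞 K) * b + ((-1256850 : ℤ) : 𝓞 K) * b ^ 2 + ((-42875 : ℤ) : 𝓞 K) * b ^ 3) * hb)).imp (fun _ h => h.1), by norm_num, by decide, by decide⟩)
  have hS4 := forall_prime_above_cons K h_29 hS3
  -- `ℓ = 31`: roots [28], treated primes [29, 13, 5, 23]
  have h_31 : ∀ P : Ideal (𝓞 K), P.IsPrime → P ≠ ⊥ → ((31 : ℕ) : 𝓞 K) ∈ P → ClassIn H P :=
    classIn_above_of_pairWitnesses K h3 b hirr hb (ℓ := 31) (by norm_num) (S := [29, 13, 5, 23]) (by decide) hS4 (fun a ha hdvd => by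
      interval_cases a <;> norm_num at hdvd
      · exact Or.inr ⟨487, -181, 13, 3, 279841, 4, [23], by norm_num, by norm_num,
          (exists_intElem_of_scaled_cubic K b (487) (-181) (13) (m := 3) (by norm_num) (-345) (163257) (8675071)
            (by push_cast; linear_combination (((-4225844 : ℤ) : 𝓞 K) + ((1094145 : ℤ) : 𝓞 K) * b + ((-85176 : ℤ) : 𝓞 K) * b ^ 2 + ((2197 : ℤ) : 𝓞 K) * b ^ 3) * hb)).imp (fun _ h => h.1), by norm_num, by decide, by decide⟩)
  have hS5 := forall_prime_above_cons K h_31 hS4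
  -- `ℓ = 37`: roots [31], treated primes [31, 29, 13, 5, 23]
  have h_37 : ∀ P : Ideal (𝓞 K), P.IsPrime → P ≠ ⊥ → ((37 : ℕ) : 𝓞 K) ∈ P → ClassIn H P :=
    classIn_above_of_pairWitnesses K h3 b hirr hb (ℓ := 37) (by norm_num) (S := [31, 29, 13, 5, 23]) (by decide) hS5 (fun a ha hdvd => by
      interval_cases a <;> norm_num at hdvd
      · exact Or.inr ⟨-79, 25, -7, 3, 16399, 2, [23, 31], by norm_num, by norm_num,
          (exists_intElem_of_scaled_cubic K b (-79) (25) (-7) (m := 3) (by norm_num) (75) (6849) (606763)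
            (by push_cast; linear_combination (((-64042 : ℤ) : 𝓞 K) + ((-5775 : ℤ) : 𝓞 K) * b + ((2646 : ℤ) : 𝓞 K) * b ^ 2 + ((-343 : ℤ) : 𝓞 K) * b ^ 3) * hb)).imp (fun _ h => h.1), by norm_num, by decide, by decide⟩)
  have hS6 := forall_prime_above_cons K h_37 hS5
  -- `ℓ = 41`: roots [27], treated primes [37, 31, 29, 13, 5, 23]
  have h_41 : ∀ P : Ideal (𝓞 K), P.IsPrime → P ≠ ⊥ → ((41 : ℕ) : 𝓞 K) ∈ P → ClassIn H P :=
    classIn_above_of_pairWitnesses K h3 b hirr hb (ℓ := 41) (by norm_num) (S := [37, 31, 29, 13, 5, 23]) (by decide) hS6 (fun a ha hdvd => by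
      interval_cases a <;> norm_num at hdvd
      · exact Or.inr ⟨5, 1, -1, 3, 37, 1, [37], by norm_num, by norm_num,
          (exists_intElem_of_scaled_cubic K b (5) (1) (-1) (m := 3) (by norm_num) (-3) (-63) (1517)
            (by push_cast; linear_combination (((-196 : ℤ) : 𝓞 K) + ((3 : ℤ) : 𝓞 K) * b + ((-1 : ℤ) : 𝓞 K) * b ^ 3) * hb)).imp (fun _ h => h.1), by norm_num, by decide, by decide⟩)
  have hS7 := forall_prime_above_cons K h_41 hS6
  -- `ℓ = 47`: roots [], treated primes [41, 37, 31, 29, 13, 5, 23]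
  have h_47 : ∀ P : Ideal (𝓞 K), P.IsPrime → P ≠ ⊥ → ((47 : ℕ) : 𝓞 K) ∈ P → ClassIn H P :=
    classIn_above_of_pairWitnesses K h3 b hirr hb (ℓ := 47) (by norm_num) (S := [41, 37, 31, 29, 13, 5, 23]) (by decide) hS7 (fun a ha hdvd => by
      interval_cases a <;> norm_num at hdvd)
  have hS8 := forall_prime_above_cons K h_47 hS7
  -- `ℓ = 53`: roots [44], treated primes [47, 41, 37, 31, 29, 13, 5, 23]
  have h_53 : ∀ P : Ideal (𝓞 K), P.IsPrime → P ≠ ⊥ → ((53 : ℕ) : 𝓞 K) ∈ P → ClassIn H P :=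
    classIn_above_of_pairWitnesses K h3 b hirr hb (ℓ := 53) (by norm_num) (S := [47, 41, 37, 31, 29, 13, 5, 23]) (by decide) hS8 (fun a ha hdvd => by
      interval_cases a <;> norm_num at hdvd
      · exact Or.inr ⟨-83, -13, -5, 3, 851, 1, [23, 37], by norm_num, by norm_num,
          (exists_intElem_of_scaled_cubic K b (-83) (-13) (-5) (m := 3) (by norm_num) (111) (-3591) (45103)
            (by push_cast; linear_combination (((-28982 : ℤ) : 𝓞 K) + ((-4485 : ℤ) : 𝓞 K) * b + ((-1350 : ℤ) : 𝓞 K) * b ^ 2 + ((-125 : ℤ) : 𝓞 K) * b ^ 3) * hb)).imp (fun _ h => h.1), by norm_num, by decide, by decide⟩)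
  have hS9 := forall_prime_above_cons K h_53 hS8
  -- `ℓ = 59`: roots [48], treated primes [53, 47, 41, 37, 31, 29, 13, 5, 23]
  have h_59 : ∀ P : Ideal (𝓞 K), P.IsPrime → P ≠ ⊥ → ((59 : ℕ) : 𝓞 K) ∈ P → ClassIn H P :=
    classIn_above_of_pairWitnesses K h3 b hirr hb (ℓ := 59) (by norm_num) (S := [53, 47, 41, 37, 31, 29, 13, 5, 23]) (by decide) hS9 (fun a ha hdvd => by
      interval_cases a <;> norm_num at hdvd
      · exact Or.inr ⟨-35, -19, 1, 3, 961, 2, [31], by norm_num, by norm_num,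
          (exists_intElem_of_scaled_cubic K b (-35) (-19) (1) (m := 3) (by norm_num) (51) (1881) (56699)
            (by push_cast; linear_combination (((-5582 : ℤ) : 𝓞 K) + ((969 : ℤ) : 𝓞 K) * b + ((-54 : ℤ) : 𝓞 K) * b ^ 2 + ((1 : ℤ) : 𝓞 K) * b ^ 3) * hb)).imp (fun _ h => h.1), by norm_num, by decide, by decide⟩)
  have hS10 := forall_prime_above_cons K h_59 hS9
  -- `ℓ = 61`: roots [41], treated primes [59, 53, 47, 41, 37, 31, 29, 13, 5, 23]
  have h_61 : ∀ P : Ideal (𝓞 K), P.IsPrime → P ≠ ⊥ → ((61 : ℕ) : 𝓞 K) ∈ P → ClassIn H P :=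
    classIn_above_of_pairWitnesses K h3 b hirr hb (ℓ := 61) (by norm_num) (S := [59, 53, 47, 41, 37, 31, 29, 13, 5, 23]) (by decide) hS10 (fun a ha hdvd => by
      interval_cases a <;> norm_num at hdvd
      · exact Or.inr ⟨-83, 26, -2, 3, 23, 1, [23], by norm_num, by norm_num,
          (exists_intElem_of_scaled_cubic K b (-83) (26) (-2) (m := 3) (by norm_num) (63) (4035) (-1403)
            (by push_cast; linear_combination (((11968 : ℤ) : 𝓞 K) + ((-3432 : ℤ) : 𝓞 K) * b + ((288 : ℤ) : 𝓞 K) * b ^ 2 + ((-8 : ℤ) : 𝓞 K) * b ^ 3) * hb)).imp (fun _ h => h.1), by norm_num, by decide, by decide⟩)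
  have hS11 := forall_prime_above_cons K h_61 hS10
  -- `ℓ = 67`: roots [], treated primes [61, 59, 53, 47, 41, 37, 31, 29, 13, 5, 23]
  have h_67 : ∀ P : Ideal (𝓞 K), P.IsPrime → P ≠ ⊥ → ((67 : ℕ) : 𝓞 K) ∈ P → ClassIn H P :=
    classIn_above_of_pairWitnesses K h3 b hirr hb (ℓ := 67) (by norm_num) (S := [61, 59, 53, 47, 41, 37, 31, 29, 13, 5, 23]) (by decide) hS11 (fun a ha hdvd => by
      interval_cases a <;> norm_num at hdvd)
  have hS12 := forall_prime_above_cons K h_67 hS11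
  -- `ℓ = 71`: roots [34], treated primes [67, 61, 59, 53, 47, 41, 37, 31, 29, 13, 5, 23]
  have h_71 : ∀ P : Ideal (𝓞 K), P.IsPrime → P ≠ ⊥ → ((71 : ℕ) : 𝓞 K) ∈ P → ClassIn H P :=
    classIn_above_of_pairWitnesses K h3 b hirr hb (ℓ := 71) (by norm_num) (S := [67, 61, 59, 53, 47, 41, 37, 31, 29, 13, 5, 23]) (by decide) hS12 (fun a ha hdvd => by
      interval_cases a <;> norm_num at hdvd
      · exact Or.inr ⟨-3, -2, 0, 1, 23, 1, [23], by norm_num, by norm_num, ⟨_, by rw [Nat.cast_one, one_mul]⟩, by norm_num, by decide, by decide⟩)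
  have hS13 := forall_prime_above_cons K h_71 hS12
  -- `ℓ = 73`: roots [9], treated primes [71, 67, 61, 59, 53, 47, 41, 37, 31, 29, 13, 5, 23]
  have h_73 : ∀ P : Ideal (𝓞 K), P.IsPrime → P ≠ ⊥ → ((73 : ℕ) : 𝓞 K) ∈ P → ClassIn H P :=
    classIn_above_of_pairWitnesses K h3 b hirr hb (ℓ := 73) (by norm_num) (S := [71, 67, 61, 59, 53, 47, 41, 37, 31, 29, 13, 5, 23]) (by decide) hS13 (fun a ha hdvd => by
      interval_cases a <;> norm_num at hdvd
      · exact Or.inr ⟨-305, 42, 0, 1, 31211, 2, [23, 59], by norm_num, by norm_num, ⟨_, by rw [Nat.cast_one, one_mul]⟩, by norm_num, by decide, by decide⟩)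
  have hS14 := forall_prime_above_cons K h_73 hS13
  -- `ℓ = 79`: roots [], treated primes [73, 71, 67, 61, 59, 53, 47, 41, 37, 31, 29, 13, 5, 23]
  have h_79 : ∀ P : Ideal (𝓞 K), P.IsPrime → P ≠ ⊥ → ((79 : ℕ) : 𝓞 K) ∈ P → ClassIn H P :=
    classIn_above_of_pairWitnesses K h3 b hirr hb (ℓ := 79) (by norm_num) (S := [73, 71, 67, 61, 59, 53, 47, 41, 37, 31, 29, 13, 5, 23]) (by decide) hS14 (fun a ha hdvd => by
      interval_cases a <;> norm_num at hdvd)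
  have hS15 := forall_prime_above_cons K h_79 hS14
  -- `ℓ = 83`: roots [44, 52, 73], treated primes [79, 73, 71, 67, 61, 59, 53, 47, 41, 37, 31, 29, 13, 5, 23]
  have h_83 : ∀ P : Ideal (𝓞 K), P.IsPrime → P ≠ ⊥ → ((83 : ℕ) : 𝓞 K) ∈ P → ClassIn H P :=
    classIn_above_of_pairWitnesses K h3 b hirr hb (ℓ := 83) (by norm_num) (S := [79, 73, 71, 67, 61, 59, 53, 47, 41, 37, 31, 29, 13, 5, 23]) (by decide) hS15 (fun a ha hdvd => by
      interval_cases a <;> norm_num at hdvd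
      · exact Or.inr ⟨727, 137, -35, 3, 31211, 2, [23, 59], by norm_num, by norm_num,
          (exists_intElem_of_scaled_cubic K b (727) (137) (-35) (m := 3) (by norm_num) (-759) (343329) (2590513)
            (by push_cast; linear_combination (((-7717142 : ℤ) : 𝓞 K) + ((-963795 : ℤ) : 𝓞 K) * b + ((374850 : ℤ) : 𝓞 K) * b ^ 2 + ((-42875 : ℤ) : 𝓞 K) * b ^ 3) * hb)).imp (fun _ h => h.1), by norm_num, by decide, by decide⟩
      · exact Or.inr ⟨-21, 2, 0, 1, 61, 1, [61], by norm_num, by norm_num, ⟨_, by rw [Nat.cast_one, one_mul]⟩, by norm_num, by decide, by decide⟩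
      · exact Or.inr ⟨-91, -14, 2, 3, 899, 1, [29, 31], by norm_num, by norm_num,
          (exists_intElem_of_scaled_cubic K b (-91) (-14) (2) (m := 3) (by norm_num) (99) (4539) (74617)
            (by push_cast; linear_combination (((-16 : ℤ) : 𝓞 K) + ((840 : ℤ) : 𝓞 K) * b + ((-144 : ℤ) : 𝓞 K) * b ^ 2 + ((8 : ℤ) : 𝓞 K) * b ^ 3) * hb)).imp (fun _ h => h.1), by norm_num, by decide, by decide⟩)
  have hS16 := forall_prime_above_cons K h_83 hS15
  -- `ℓ = 89`: roots [4], treated primes [83, 79, 73, 71, 67, 61, 59, 53, 47, 41, 37, 31, 29, 13, 5, 23]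
  have h_89 : ∀ P : Ideal (𝓞 K), P.IsPrime → P ≠ ⊥ → ((89 : ℕ) : 𝓞 K) ∈ P → ClassIn H P :=
    classIn_above_of_pairWitnesses K h3 b hirr hb (ℓ := 89) (by norm_num) (S := [83, 79, 73, 71, 67, 61, 59, 53, 47, 41, 37, 31, 29, 13, 5, 23]) (by decide) hS16 (fun a ha hdvd => by
      interval_cases a <;> norm_num at hdvd
      · exact Or.inr ⟨-41, -4, -2, 3, 29, 1, [29], by norm_num, by norm_num,
          (exists_intElem_of_scaled_cubic K b (-41) (-4) (-2) (m := 3) (by norm_num) (51) (-201) (2581)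
            (by push_cast; linear_combination (((-1712 : ℤ) : 𝓞 K) + ((-192 : ℤ) : 𝓞 K) * b + ((-72 : ℤ) : 𝓞 K) * b ^ 2 + ((-8 : ℤ) : 𝓞 K) * b ^ 3) * hb)).imp (fun _ h => h.1), by norm_num, by decide, by decide⟩)
  have hS17 := forall_prime_above_cons K h_89 hS16
  -- `ℓ = 2`: roots [0, 1], treated primes [89, 83, 79, 73, 71, 67, 61, 59, 53, 47, 41, 37, 31, 29, 13, 5, 23]
  have h_2 : ∀ P : Ideal (𝓞 K), P.IsPrime → P ≠ ⊥ → ((2 : ℕ) : 𝓞 K) ∈ P → ClassIn H P :=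
    classIn_above_of_pairWitnesses K h3 b hirr hb (ℓ := 2) (by norm_num) (S := [89, 83, 79, 73, 71, 67, 61, 59, 53, 47, 41, 37, 31, 29, 13, 5, 23]) (by decide) hS17 (fun a ha hdvd => by
      interval_cases a <;> norm_num at hdvd
      · exact Or.inr ⟨-4, 1, 0, 1, 89, 1, [89], by norm_num, by norm_num, ⟨_, by rw [Nat.cast_one, one_mul]⟩, by norm_num, by decide, by decide⟩
      · exact Or.inr ⟨-7, 1, 0, 1, 1, 0, [], by norm_num, by norm_num, ⟨_, by rw [Nat.cast_one, one_mul]⟩, by norm_num, by decide, by decide⟩)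
  have hS18 := forall_prime_above_cons K h_2 hS17
  -- `ℓ = 3`: roots [0], treated primes [2, 89, 83, 79, 73, 71, 67, 61, 59, 53, 47, 41, 37, 31, 29, 13, 5, 23] (second generator `b₂`)
  have h_3 : ∀ P : Ideal (𝓞 K), P.IsPrime → P ≠ ⊥ → ((3 : ℕ) : 𝓞 K) ∈ P → ClassIn H P :=
    classIn_above_of_pairWitnesses K h3 b₂ hirr₂ hb₂ (ℓ := 3) (by norm_num) (S := [2, 89, 83, 79, 73, 71, 67, 61, 59, 53, 47, 41, 37, 31, 29, 13, 5, 23]) (by decide) hS18 (fun a ha hdvd => by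
      interval_cases a <;> norm_num at hdvd
      · exact Or.inr ⟨-3, -1, 0, 1, 256, 8, [2], by norm_num, by norm_num, ⟨_, by rw [Nat.cast_one, one_mul]⟩, by norm_num, by decide, by decide⟩)
  have hS19 := forall_prime_above_cons K h_3 hS18
  -- `ℓ = 7`: roots [1], treated primes [3, 2, 89, 83, 79, 73, 71, 67, 61, 59, 53, 47, 41, 37, 31, 29, 13, 5, 23]
  have h_7 : ∀ P : Ideal (𝓞 K), P.IsPrime → P ≠ ⊥ → ((7 : ℕ) : 𝓞 K) ∈ P → ClassIn H P :=
    classIn_above_of_pairWitnesses K h3 b hirr hb (ℓ := 7) (by norm_num) (S := [3, 2, 89, 83, 79, 73, 71, 67, 61, 59, 53, 47, 41, 37, 31, 29, 13, 5, 23]) (by decide) hS19 (fun a ha hdvd => by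
      interval_cases a <;> norm_num at hdvd
      · exact Or.inr ⟨-7, 1, -1, 3, 183, 1, [3, 61], by norm_num, by norm_num,
          (exists_intElem_of_scaled_cubic K b (-7) (1) (-1) (m := 3) (by norm_num) (9) (-39) (1281)
            (by push_cast; linear_combination (((-196 : ℤ) : 𝓞 K) + ((3 : ℤ) : 𝓞 K) * b + ((-1 : ℤ) : 𝓞 K) * b ^ 3) * hb)).imp (fun _ h => h.1), by norm_num, by decide, by decide⟩)
  have hS20 := forall_prime_above_cons K h_7 hS19
  -- `ℓ = 11`: roots [2, 10], treated primes [7, 3, 2, 89, 83, 79, 73, 71, 67, 61, 59, 53, 47, 41, 37, 31, 29, 13, 5, 23]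
  have h_11 : ∀ P : Ideal (𝓞 K), P.IsPrime → P ≠ ⊥ → ((11 : ℕ) : 𝓞 K) ∈ P → ClassIn H P :=
    classIn_above_of_pairWitnesses K h3 b hirr hb (ℓ := 11) (by norm_num) (S := [7, 3, 2, 89, 83, 79, 73, 71, 67, 61, 59, 53, 47, 41, 37, 31, 29, 13, 5, 23]) (by decide) hS20 (fun a ha hdvd => by
      interval_cases a <;> norm_num at hdvd
      · exact Or.inr ⟨2, -1, 0, 1, 18, 2, [2, 3], by norm_num, by norm_num, ⟨_, by rw [Nat.cast_one, one_mul]⟩, by norm_num, by decide, by decide⟩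
      · exact Or.inr ⟨-1, -1, 0, 1, 18, 2, [2, 3], by norm_num, by norm_num, ⟨_, by rw [Nat.cast_one, one_mul]⟩, by norm_num, by decide, by decide⟩)
  have hS21 := forall_prime_above_cons K h_11 hS20
  -- `ℓ = 17`: roots [13], treated primes [11, 7, 3, 2, 89, 83, 79, 73, 71, 67, 61, 59, 53, 47, 41, 37, 31, 29, 13, 5, 23]
  have h_17 : ∀ P : Ideal (𝓞 K), P.IsPrime → P ≠ ⊥ → ((17 : ℕ) : 𝓞 K) ∈ P → ClassIn H P :=
    classIn_above_of_pairWitnesses K h3 b hirr hb (ℓ := 17) (by norm_num) (S := [11, 7, 3, 2, 89, 83, 79, 73, 71, 67, 61, 59, 53, 47, 41, 37, 31, 29, 13, 5, 23]) (by decide) hS21 (fun a ha hdvd => by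
      interval_cases a <;> norm_num at hdvd
      · exact Or.inr ⟨-4, -5, -1, 3, 132, 2, [2, 3, 11], by norm_num, by norm_num,
          (exists_intElem_of_scaled_cubic K b (-4) (-5) (-1) (m := 3) (by norm_num) (12) (-426) (2244)
            (by push_cast; linear_combination (((-394 : ℤ) : 𝓞 K) + ((-105 : ℤ) : 𝓞 K) * b + ((-18 : ℤ) : 𝓞 K) * b ^ 2 + ((-1 : ℤ) : 𝓞 K) * b ^ 3) * hb)).imp (fun _ h => h.1), by norm_num, by decide, by decide⟩)
  have hS22 := forall_prime_above_cons K h_17 hS21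
  -- `ℓ = 19`: roots [12], treated primes [17, 11, 7, 3, 2, 89, 83, 79, 73, 71, 67, 61, 59, 53, 47, 41, 37, 31, 29, 13, 5, 23]
  have h_19 : ∀ P : Ideal (𝓞 K), P.IsPrime → P ≠ ⊥ → ((19 : ℕ) : 𝓞 K) ∈ P → ClassIn H P :=
    classIn_above_of_pairWitnesses K h3 b hirr hb (ℓ := 19) (by norm_num) (S := [17, 11, 7, 3, 2, 89, 83, 79, 73, 71, 67, 61, 59, 53, 47, 41, 37, 31, 29, 13, 5, 23]) (by decide) hS22 (fun a ha hdvd => by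
      interval_cases a <;> norm_num at hdvd
      · exact Or.inr ⟨-1, 1, -1, 3, 73, 1, [73], by norm_num, by norm_num,
          (exists_intElem_of_scaled_cubic K b (-1) (1) (-1) (m := 3) (by norm_num) (3) (-63) (1387)
            (by push_cast; linear_combination (((-196 : ℤ) : 𝓞 K) + ((3 : ℤ) : 𝓞 K) * b + ((-1 : ℤ) : 𝓞 K) * b ^ 3) * hb)).imp (fun _ h => h.1), by norm_num, by decide, by decide⟩)
  have hS23 := forall_prime_above_cons K h_19 hS22
  -- `ℓ = 43`: roots [6, 11, 29], treated primes [19, 17, 11, 7, 3, 2, 89, 83, 79, 73, 71, 67, 61, 59, 53, 47, 41, 37, 31, 29, 13, 5, 23]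
  have h_43 : ∀ P : Ideal (𝓞 K), P.IsPrime → P ≠ ⊥ → ((43 : ℕ) : 𝓞 K) ∈ P → ClassIn H P :=
    classIn_above_of_pairWitnesses K h3 b hirr hb (ℓ := 43) (by norm_num) (S := [19, 17, 11, 7, 3, 2, 89, 83, 79, 73, 71, 67, 61, 59, 53, 47, 41, 37, 31, 29, 13, 5, 23]) (by decide) hS23 (fun a ha hdvd => by
      interval_cases a <;> norm_num at hdvd
      · exact Or.inr ⟨5, -2, -1, 3, 46, 1, [2, 23], by norm_num, by norm_num,
          (exists_intElem_of_scaled_cubic K b (5) (-2) (-1) (m := 3) (by norm_num) (0) (-267) (1978)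
            (by push_cast; linear_combination (((-214 : ℤ) : 𝓞 K) + ((-24 : ℤ) : 𝓞 K) * b + ((-9 : ℤ) : 𝓞 K) * b ^ 2 + ((-1 : ℤ) : 𝓞 K) * b ^ 3) * hb)).imp (fun _ h => h.1), by norm_num, by decide, by decide⟩
      · exact Or.inr ⟨-5, -1, -2, 3, 236, 2, [2, 59], by norm_num, by norm_num,
          (exists_intElem_of_scaled_cubic K b (-5) (-1) (-2) (m := 3) (by norm_num) (12) (-615) (10148)
            (by push_cast; linear_combination (((-1559 : ℤ) : 𝓞 K) + ((-30 : ℤ) : 𝓞 K) * b + ((-36 : ℤ) : 𝓞 K) * b ^ 2 + ((-8 : ℤ) : 𝓞 K) * b ^ 3) * hb)).imp (fun _ h => h.1), by norm_num, by decide, by decide⟩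
      · exact Or.inr ⟨-4, -2, -1, 3, 28, 2, [2, 7], by norm_num, by norm_num,
          (exists_intElem_of_scaled_cubic K b (-4) (-2) (-1) (m := 3) (by norm_num) (9) (-240) (1204)
            (by push_cast; linear_combination (((-214 : ℤ) : 𝓞 K) + ((-24 : ℤ) : 𝓞 K) * b + ((-9 : ℤ) : 𝓞 K) * b ^ 2 + ((-1 : ℤ) : 𝓞 K) * b ^ 3) * hb)).imp (fun _ h => h.1), by norm_num, by decide, by decide⟩)
  have hS24 := forall_prime_above_cons K h_43 hS23
  exact subgroup_eq_top_of_forall_prime_lt K h3 hM (forall_prime_lt_of_forall_mem K (S := [43, 19, 17, 11, 7, 3, 2, 89, 83, 79, 73, 71, 67, 61, 59, 53, 47, 41, 37, 31, 29, 13, 5, 23]) (by decide) hS24)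

end KSide

/-! ## §2 L-side: the ideal identity in `𝓞 K₁` -/

/-- **The capitulation identity for `460944bn1`**: in any commutative ring with `B³ + (-3)B² + (0)B + (-194) = 0` and `S² = 2, together with Ω = ω = (1 + 2B + B²)/3 (the second generator of 𝓞 K, index 3) and the half-integral W = −(B+B²)S/2 of 𝓞 K₁`,
`(y) · (23, B − 10, s + 5) = (23) · (23, B − 10, s − 5)` for the displayed `y` (coefficients found by LLL in the order
`𝓞 K₁ = ℤ⟨ω, θ, θ², ωs, (θ+θ²)s/2, θ²s⟩ (identities certified after multiplication by 36)` of `K₁ = ℚ(θ, √2)`; each membership is a polynomial identity modulo the two relations). KERNEL.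
[cite: Gras2003, II.6.2 (ambiguous ideal classes)] [cite: Cohen2000, §2.3] -/
theorem capitulationIdentity_d115236n {L : Type} [Field L] [NumberField L] (B S Ω W : 𝓞 L)
    (hB : B ^ 3 + ((-3 : ℤ) : 𝓞 L) * B ^ 2 + ((0 : ℤ) : 𝓞 L) * B + ((-194 : ℤ) : 𝓞 L) = 0) (hS : S ^ 2 = 2)
    (hA₁ : ((3 : ℕ) : 𝓞 L) * Ω = ((1 : ℤ) : 𝓞 L) + ((2 : ℤ) : 𝓞 L) * B + ((1 : ℤ) : 𝓞 L) * B ^ 2) (hA₂ : 2 * W = ((-1 : ℤ) : 𝓞 L) * B * S + ((-1 : ℤ) : 𝓞 L) * B ^ 2 * S) :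
    ∃ y : 𝓞 L, (∃ u v w : 𝓞 L, y * ((23 : ℕ) : 𝓞 L) = ((23 : ℕ) : 𝓞 L) * (u * ((23 : ℕ) : 𝓞 L) + v * (B - ((10 : ℕ) : 𝓞 L)) + w * (S - ((5 : ℤ) : 𝓞 L)))) ∧
      (∃ u v w : 𝓞 L, y * (B - ((10 : ℕ) : 𝓞 L)) = ((23 : ℕ) : 𝓞 L) * (u * ((23 : ℕ) : 𝓞 L) + v * (B - ((10 : ℕ) : 𝓞 L)) + w * (S - ((5 : ℤ) : 𝓞 L)))) ∧
      (∃ u v w : 𝓞 L, y * (S + ((5 : ℤ) : 𝓞 L)) = ((23 : ℕ) : 𝓞 L) * (u * ((23 : ℕ) : 𝓞 L) + v * (B - ((10 : ℕ) : 𝓞 L)) + w * (S - ((5 : ℤ) : 𝓞 L)))) ∧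
      (∃ u v w : 𝓞 L, ((23 : ℕ) : 𝓞 L) * ((23 : ℕ) : 𝓞 L) = y * (u * ((23 : ℕ) : 𝓞 L) + v * (B - ((10 : ℕ) : 𝓞 L)) + w * (S + ((5 : ℤ) : 𝓞 L)))) ∧
      (∃ u v w : 𝓞 L, ((23 : ℕ) : 𝓞 L) * (B - ((10 : ℕ) : 𝓞 L)) = y * (u * ((23 : ℕ) : 𝓞 L) + v * (B - ((10 : ℕ) : 𝓞 L)) + w * (S + ((5 : ℤ) : 𝓞 L)))) ∧
      (∃ u v w : 𝓞 L, ((23 : ℕ) : 𝓞 L) * (S - ((5 : ℤ) : 𝓞 L)) = y * (u * ((23 : ℕ) : 𝓞 L) + v * (B - ((10 : ℕ) : 𝓞 L)) + w * (S + ((5 : ℤ) : 𝓞 L)))) := by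
  have hF : (36 : 𝓞 L) ≠ 0 := by norm_num
  have hA₁₁ : (((3 : ℕ) : 𝓞 L) * Ω) * (((3 : ℕ) : 𝓞 L) * Ω) = (((1 : ℤ) : 𝓞 L) + ((2 : ℤ) : 𝓞 L) * B + ((1 : ℤ) : 𝓞 L) * B ^ 2) * (((1 : ℤ) : 𝓞 L) + ((2 : ℤ) : 𝓞 L) * B + ((1 : ℤ) : 𝓞 L) * B ^ 2) := by rw [hA₁]
  have hA₁₂ : (((3 : ℕ) : 𝓞 L) * Ω) * (2 * W) = (((1 : ℤ) : 𝓞 L) + ((2 : ℤ) : 𝓞 L) * B + ((1 : ℤ) : 𝓞 L) * B ^ 2) * (((-1 : ℤ) : 𝓞 L) * B * S + ((-1 : ℤ) : 𝓞 L) * B ^ 2 * S) := by rw [hA₁, hA₂]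
  have hA₂₂ : (2 * W) * (2 * W) = (((-1 : ℤ) : 𝓞 L) * B * S + ((-1 : ℤ) : 𝓞 L) * B ^ 2 * S) * (((-1 : ℤ) : 𝓞 L) * B * S + ((-1 : ℤ) : 𝓞 L) * B ^ 2 * S) := by rw [hA₂]
  refine ⟨((7 : ℤ) : 𝓞 L) * B + ((-17 : ℤ) : 𝓞 L) * B ^ 2 * S + (((-80 : ℤ) : 𝓞 L)) * W + (((-5 : ℤ) : 𝓞 L) + ((-68 : ℤ) : 𝓞 L) * S) * Ω, ?_, ?_, ?_, ?_, ?_, ?_⟩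
  · exact ⟨((-1 : ℤ) : 𝓞 L) * B ^ 2 * S + (((-3 : ℤ) : 𝓞 L)) * W + (((-3 : ℤ) : 𝓞 L) * S) * Ω, (0 : 𝓞 L), ((-2 : ℤ) : 𝓞 L) * B + ((-1 : ℤ) : 𝓞 L) * B ^ 2 + ((-1 : ℤ) : 𝓞 L) * B ^ 2 * S + (((3 : ℤ) : 𝓞 L)) * W + (((1 : ℤ) : 𝓞 L)) * Ω, mul_left_cancel₀ hF (by push_cast; linear_combination (((1656 : ℤ) : 𝓞 L) + ((-1242 : ℤ) : 𝓞 L) * S) * hA₂ + (((1242 : ℤ) : 𝓞 L) * B + ((2070 : ℤ) : 𝓞 L) * B ^ 2) * hS)⟩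
  · exact ⟨((1 : ℤ) : 𝓞 L) * B + ((1 : ℤ) : 𝓞 L) * B ^ 2 + (((-1 : ℤ) : 𝓞 L)) * Ω, ((-1 : ℤ) : 𝓞 L) * B + ((-1 : ℤ) : 𝓞 L) * B ^ 2 * S + (((-4 : ℤ) : 𝓞 L)) * W + (((-3 : ℤ) : 𝓞 L) * S) * Ω, ((2 : ℤ) : 𝓞 L) * B + ((2 : ℤ) : 𝓞 L) * B ^ 2 + (((-2 : ℤ) : 𝓞 L)) * W + (((3 : ℤ) : 𝓞 L) + ((-1 : ℤ) : 𝓞 L) * S) * Ω, mul_left_cancel₀ hF (by push_cast; linear_combination (((11088 : ℤ) : 𝓞 L) + ((-2328 : ℤ) : 𝓞 L) * S + ((276 : ℤ) : 𝓞 L) * S ^ 2 + ((-60 : ℤ) : 𝓞 L) * B + ((12 : ℤ) : 𝓞 L) * B * S) * hA₁ + (((-6300 : ℤ) : 𝓞 L) + ((828 : ℤ) : 𝓞 L) * S + ((216 : ℤ) : 𝓞 L) * B) * hA₂ + (((-60 : ℤ) : 𝓞 L) + ((12 : ℤ) : 𝓞 L) * S) * hB + (((276 : ℤ) : 𝓞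 L) + ((-276 : ℤ) : 𝓞 L) * B + ((-552 : ℤ) : 𝓞 L) * B ^ 2) * hS)⟩
  · exact ⟨(((3 : ℤ) : 𝓞 L)) * W + (((1 : ℤ) : 𝓞 L) + ((4 : ℤ) : 𝓞 L) * S) * Ω, ((-1 : ℤ) : 𝓞 L) * B + ((-1 : ℤ) : 𝓞 L) * B ^ 2 + ((-3 : ℤ) : 𝓞 L) * B ^ 2 * S + (((-5 : ℤ) : 𝓞 L)) * W + (((3 : ℤ) : 𝓞 L) + ((1 : ℤ) : 𝓞 L) * S) * Ω, ((1 : ℤ) : 𝓞 L) * B + ((2 : ℤ) : 𝓞 L) * B ^ 2 + ((1 : ℤ) : 𝓞 L) * B ^ 2 * S + (((1 : ℤ) : 𝓞 L)) * W, mul_left_cancel₀ hF (by push_cast; linear_combination (((1632 : ℤ) : 𝓞 L) + ((-26772 : ℤ) : 𝓞 L) * S + ((-816 : ℤ) : 𝓞 L) * S ^ 2 + ((-828 : ℤ) : 𝓞 L) * B + ((-276 : ℤ) : 𝓞 L) * B * S) * hA₁ + (((-54396 : ℤ) : 𝓞 L) + ((-1854 : ℤ) : 𝓞 L) * S + ((2070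 : ℤ) : 𝓞 L) * B) * hA₂ + (((138 : ℤ) : 𝓞 L) * S) * hB + (((-816 : ℤ) : 𝓞 L) + ((222 : ℤ) : 𝓞 L) * B + ((-402 : ℤ) : 𝓞 L) * B ^ 2) * hS)⟩
  · exact ⟨((-1 : ℤ) : 𝓞 L) * B ^ 2 * S + (((-4 : ℤ) : 𝓞 L)) * W + (((-3 : ℤ) : 𝓞 L) * S) * Ω, (0 : 𝓞 L), ((-1 : ℤ) : 𝓞 L) * B + ((1 : ℤ) : 𝓞 L) * B ^ 2 * S + (((2 : ℤ) : 𝓞 L)) * W + (((1 : ℤ) : 𝓞 L)) * Ω, mul_left_cancel₀ hF (by push_cast; linear_combination (((-720 : ℤ) : 𝓞 L) * B + ((1572 : ℤ) : 𝓞 L) * B * S + ((-816 : ℤ) : 𝓞 L) * B * S ^ 2 + ((-60 : ℤ) : 𝓞 L) * B ^ 2 * S + ((-28500 : ℤ) : 𝓞 L) * B ^ 2 * S ^ 2 + ((816 : ℤ) : 𝓞 L) * B ^ 2 * S ^ 3) * hA₁ + (((3132 : ℤ) : 𝓞 L) * B + ((-1692 : ℤ) : 𝓞 L) * B * S + ((-51012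 : ℤ) : 𝓞 L) * B ^ 2 * S + ((2052 : ℤ) : 𝓞 L) * B ^ 2 * S ^ 2) * hA₂ + (((100 : ℤ) : 𝓞 L) + ((-18496 : ℤ) : 𝓞 L) * S ^ 2) * hA₁₁ + (((-60 : ℤ) : 𝓞 L) + ((-66036 : ℤ) : 𝓞 L) * S + ((816 : ℤ) : 𝓞 L) * S ^ 2) * hA₁₂ + (((-59040 : ℤ) : 𝓞 L) + ((1440 : ℤ) : 𝓞 L) * S) * hA₂₂ + (((92 : ℤ) : 𝓞 L) + ((92 : ℤ) : 𝓞 L) * B) * hB + (((-18496 : ℤ) : 𝓞 L) + ((-8764 : ℤ) : 𝓞 L) * B + ((-816 : ℤ) : 𝓞 L) * B * S + ((-348 : ℤ) : 𝓞 L) * B ^ 2 + ((-192 : ℤ) : 𝓞 L) * B ^ 2 * S + ((68 : ℤ) : 𝓞 L) * B ^ 3 + ((12 : ℤ) : 𝓞 L) * B ^ 3 * S + ((-4 : ℤ) : 𝓞 L) * B ^ 4) * hS)⟩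
  · exact ⟨((-1 : ℤ) : 𝓞 L) * B + ((-1 : ℤ) : 𝓞 L) * B ^ 2 + (((1 : ℤ) : 𝓞 L)) * Ω, ((1 : ℤ) : 𝓞 L) * B + ((-1 : ℤ) : 𝓞 L) * B ^ 2 * S + (((-4 : ℤ) : 𝓞 L)) * W + (((-3 : ℤ) : 𝓞 L) * S) * Ω, ((2 : ℤ) : 𝓞 L) * B + ((2 : ℤ) : 𝓞 L) * B ^ 2 + (((2 : ℤ) : 𝓞 L)) * W + (((3 : ℤ) : 𝓞 L) + ((1 : ℤ) : 𝓞 L) * S) * Ω, mul_left_cancel₀ hF (by push_cast; linear_combination (((-4572 : ℤ) : 𝓞 L) * B + ((-21840 : ℤ) : 𝓞 L) * B * S + ((1548 : ℤ) : 𝓞 L) * B * S ^ 2 + ((-720 : ℤ) : 𝓞 L) * B ^ 2 + ((-1068 : ℤ) : 𝓞 L) * B ^ 2 * S + ((17544 : ℤ) : 𝓞 L) * B ^ 2 * S ^ 2 + ((204 : ℤ) : 𝓞 L) * B ^ 2 * S ^ 3 + ((-60 : ℤ) : 𝓞 L) * B ^ 3 * S + ((-1428 : ℤ) : 𝓞 L)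 * B ^ 3 * S ^ 2) * hA₁ + (((-39420 : ℤ) : 𝓞 L) * B + ((2628 : ℤ) : 𝓞 L) * B * S + ((-16776 : ℤ) : 𝓞 L) * B ^ 2 + ((32580 : ℤ) : 𝓞 L) * B ^ 2 * S + ((612 : ℤ) : 𝓞 L) * B ^ 2 * S ^ 2 + ((-2664 : ℤ) : 𝓞 L) * B ^ 3 * S) * hA₂ + (((760 : ℤ) : 𝓞 L) + ((11096 : ℤ) : 𝓞 L) * S + ((10356 : ℤ) : 𝓞 L) * S ^ 2 + ((272 : ℤ) : 𝓞 L) * S ^ 3 + ((-60 : ℤ) : 𝓞 L) * B * S + ((-816 : ℤ) : 𝓞 L) * B * S ^ 2) * hA₁₁ + (((19740 : ℤ) : 𝓞 L) + ((38700 : ℤ) : 𝓞 L) * S + ((1296 : ℤ) : 𝓞 L) * S ^ 2 + ((-120 : ℤ) : 𝓞 L) * B + ((-3072 : ℤ) : 𝓞 L) * B * S) * hA₁₂ + (((36000 : ℤ) : 𝓞 L) + ((1440 : ℤ) : 𝓞 L) * S + ((-2880 : ℤ) : 𝓞 L) * B) * hA₂₂ + (((-68 : ℤ) : 𝓞 L)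 + ((-60 : ℤ) : 𝓞 L) * S + ((-32 : ℤ) : 𝓞 L) * B + ((-12 : ℤ) : 𝓞 L) * B * S) * hB + (((10356 : ℤ) : 𝓞 L) + ((272 : ℤ) : 𝓞 L) * S + ((3456 : ℤ) : 𝓞 L) * B + ((-208 : ℤ) : 𝓞 L) * B * S + ((-144 : ℤ) : 𝓞 L) * B ^ 2 + ((-612 : ℤ) : 𝓞 L) * B ^ 2 * S + ((-12 : ℤ) : 𝓞 L) * B ^ 3 + ((-124 : ℤ) : 𝓞 L) * B ^ 3 * S + ((-36 : ℤ) : 𝓞 L) * B ^ 4 + ((8 : ℤ) : 𝓞 L) * B ^ 4 * S) * hS)⟩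
  · exact ⟨(((-3 : ℤ) : 𝓞 L)) * W + (((1 : ℤ) : 𝓞 L) + ((-4 : ℤ) : 𝓞 L) * S) * Ω, ((-1 : ℤ) : 𝓞 L) * B + ((-1 : ℤ) : 𝓞 L) * B ^ 2 + ((3 : ℤ) : 𝓞 L) * B ^ 2 * S + (((5 : ℤ) : 𝓞 L)) * W + (((3 : ℤ) : 𝓞 L) + ((-1 : ℤ) : 𝓞 L) * S) * Ω, ((-1 : ℤ) : 𝓞 L) * B + ((-2 : ℤ) : 𝓞 L) * B ^ 2 + ((1 : ℤ) : 𝓞 L) * B ^ 2 * S + (((1 : ℤ) : 𝓞 L)) * W, mul_left_cancel₀ hF (by push_cast; linear_combination (((888 : ℤ) : 𝓞 L) * B + ((10908 : ℤ) : 𝓞 L) * B * S + ((-816 : ℤ) : 𝓞 L) * B * S ^ 2 + ((-312 : ℤ) : 𝓞 L) * B ^ 2 + ((-3780 : ℤ) : 𝓞 L) * B ^ 2 * S + ((-38700 : ℤ) : 𝓞 L) * B ^ 2 * S ^ 2 + ((816 : ℤ) : 𝓞 L) * B ^ 2 * S ^ 3 + ((-60 : ℤ) : 𝓞 L) * B ^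 3 + ((-24 : ℤ) : 𝓞 L) * B ^ 3 * S + ((2244 : ℤ) : 𝓞 L) * B ^ 3 * S ^ 2) * hA₁ + (((21564 : ℤ) : 𝓞 L) * B + ((-1566 : ℤ) : 𝓞 L) * B * S + ((-2070 : ℤ) : 𝓞 L) * B ^ 2 + ((-73764 : ℤ) : 𝓞 L) * B ^ 2 * S + ((1746 : ℤ) : 𝓞 L) * B ^ 2 * S ^ 2 + ((-1440 : ℤ) : 𝓞 L) * B ^ 3 + ((5850 : ℤ) : 𝓞 L) * B ^ 3 * S) * hA₂ + (((-140 : ℤ) : 𝓞 L) + ((-3544 : ℤ) : 𝓞 L) * S + ((-22304 : ℤ) : 𝓞 L) * S ^ 2 + ((60 : ℤ) : 𝓞 L) * B + ((796 : ℤ) : 𝓞 L) * B * S + ((-272 : ℤ) : 𝓞 L) * B * S ^ 2) * hA₁₁ + (((-6780 : ℤ) : 𝓞 L) + ((-85842 : ℤ) : 𝓞 L) * S + ((408 : ℤ) : 𝓞 L) * S ^ 2 + ((1590 : ℤ) : 𝓞 L) * B + ((1560 : ℤ) : 𝓞 L) * B * S) * hA₁₂ + (((-82080 : ℤ) : 𝓞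 L) + ((720 : ℤ) : 𝓞 L) * S + ((3600 : ℤ) : 𝓞 L) * B) * hA₂₂ + (((252 : ℤ) : 𝓞 L) + ((14 : ℤ) : 𝓞 L) * S + ((44 : ℤ) : 𝓞 L) * B + ((-18 : ℤ) : 𝓞 L) * B * S + ((-4 : ℤ) : 𝓞 L) * B ^ 2 + ((10 : ℤ) : 𝓞 L) * B ^ 2 * S) * hB + (((-22304 : ℤ) : 𝓞 L) + ((-4462 : ℤ) : 𝓞 L) * B + ((-408 : ℤ) : 𝓞 L) * B * S + ((208 : ℤ) : 𝓞 L) * B ^ 2 + ((312 : ℤ) : 𝓞 L) * B ^ 2 * S + ((-68 : ℤ) : 𝓞 L) * B ^ 3 + ((102 : ℤ) : 𝓞 L) * B ^ 3 * S + ((68 : ℤ) : 𝓞 L) * B ^ 4 + ((-6 : ℤ) : 𝓞 L) * B ^ 4 * S + ((-2 : ℤ) : 𝓞 L) * B ^ 5) * hS)⟩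

/-! ## §3 The displayed hypothesis `e₁ = e₀` discharged, and the census stamp -/

/-- **`e₁ = e₀` along the cyclotomic `ℤ₂`-tower of `ℚ(θ)`**, `θ` any root of `X³ + (-3)X² + (0)X + (-194)` — the displayed hypothesis
`h01` of `conjA_two_460944bn1_of_fukudaLayers`, now KERNEL: §1 (`h_K = ord [𝔮]`), §2 (the ambiguous class above `𝔮`), and
the door with TWO primes above `2` (`2 = 𝔭²𝔮`, `4 ∤ g(0)`, `4 ∤ g(3)`) `classNumberPExp_one_eq_classNumberPExp_zero_of_ambiguous_of_nonNorm_unit` (`…CapitulationDoorTwoPrimes`) with the fundamental unit `ε = (290964739325664831989 + 41680179161988774559θ + 10470065944049864735θ²)/3` (`N ε = 1`, `ε ↦ 5 (mod 8)` under `θ ↦ z ≡ 5`: not a norm from `K(√2)`).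
[cite: Lang1990, Ch. 13 §4, Lemma 4.1] [cite: Gras2003, II.6.2.3] [cite: Fukuda1994, Thm. 1 (1), p. 264] -/
theorem classNumberPExp_one_eq_zero_layer_d115236n {θ : AlgebraicClosure ℚ}
    (hθ : aeval θ (Cubic.toPoly ⟨1, ((-3 : ℤ) : ℚ), ((0 : ℤ) : ℚ), ((-194 : ℤ) : ℚ)⟩) = 0) :
    haveI : FiniteDimensional ℚ (IntermediateField.adjoin ℚ {θ}) :=
      IntermediateField.adjoin.finiteDimensional ((AlgebraicClosure.isAlgebraic ℚ).isAlgebraic θ).isIntegral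
    haveI : NumberField (IntermediateField.adjoin ℚ {θ}) := NumberField.mk
    ∀ κL : ZpExtension (IntermediateField.adjoin ℚ {θ}) 2, κL.IsCyclotomic → classNumberPExp κL 1 = classNumberPExp κL 0 := by
  haveI : FiniteDimensional ℚ (IntermediateField.adjoin ℚ {θ}) :=
    IntermediateField.adjoin.finiteDimensional ((AlgebraicClosure.isAlgebraic ℚ).isAlgebraic θ).isIntegral
  haveI : NumberField (IntermediateField.adjoin ℚ {θ}) := NumberField.mk
  intro κL hκL
  have hirr := irreducible_cubic_d115236n
  have h3 := finrank_adjoin_eq_three_of_irreducible hirr hθ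
  obtain ⟨b, -, hb⟩ := exists_ringOfIntegers_cubic_root (p := -3) (q := 0) (r := -194) hθ
  have hs2 := ncard_primes_above_two_le_two _ h3 b hirr hb ⟨0, by norm_num⟩ ⟨1, by norm_num⟩
  have hθ' : θ ^ 3 + (-3 : AlgebraicClosure ℚ) * θ ^ 2 + (0 : AlgebraicClosure ℚ) * θ + (-194 : AlgebraicClosure ℚ) = 0 := by
    have := hθ
    simp only [Cubic.toPoly, map_one, one_mul, aeval_add, aeval_mul, aeval_C, aeval_X_pow, aeval_X,
      eq_ratCast, Rat.cast_intCast] at this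
    push_cast at this
    linear_combination this
  have he : aeval (algebraMap ℚ (AlgebraicClosure ℚ) (((290964739325664831989 : ℤ) : ℚ) / ((3 : ℤ) : ℚ)) +
      algebraMap ℚ (AlgebraicClosure ℚ) (((41680179161988774559 : ℤ) : ℚ) / ((3 : ℤ) : ℚ)) * θ +
      algebraMap ℚ (AlgebraicClosure ℚ) (((10470065944049864735 : ℤ) : ℚ) / ((3 : ℤ) : ℚ)) * θ ^ 2)
      (Cubic.toPoly ⟨1, ((-364055116319803200753 : ℤ) : ℚ), ((20660173401 : ℤ) : ℚ), ((-1 : ℤ) : ℚ)⟩) = 0 := by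
    simp only [Cubic.toPoly, map_one, one_mul, aeval_add, aeval_mul, aeval_C, aeval_X_pow, aeval_X, eq_ratCast,
      Rat.cast_intCast, Rat.cast_div]
    push_cast
    linear_combination (((349639318618576610180381648110185123801056502133389700874234 : AlgebraicClosure ℚ) / 27) + ((81981426214509410408739143169629633143972801269144236967255 : AlgebraicClosure ℚ) / 27) * θ + ((17150486449791207227920065531288333570437969498901240363450 : AlgebraicClosure ℚ) / 27) * θ ^ 2 + ((1147752509674877820503940810257783677244476870341415265375 : AlgebraicClosure ℚ) / 27) * θ ^ 3) * hθ'
  obtain ⟨ε, hεu, hnn⟩ := exists_nonNorm_unit_of_padicCert hirr hθ (290964739325664831989) (41680179161988774559) (10470065944049864735) (3) (-364055116319803200753) (20660173401) (-1) (by norm_num) he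
    (5) (3) (by norm_num) (by norm_num) (by decide) (by decide)
  have h0 : Ideal.span ({((23 : ℕ) : 𝓞 (IntermediateField.adjoin ℚ {θ})), b - ((10 : ℕ) : 𝓞 (IntermediateField.adjoin ℚ {θ}))} : Set _) ∈
      (Ideal (𝓞 (IntermediateField.adjoin ℚ {θ})))⁰ := by
    refine mem_nonZeroDivisors_of_ne_zero fun h => ?_
    have hmem : ((23 : ℕ) : 𝓞 (IntermediateField.adjoin ℚ {θ})) ∈
        Ideal.span ({((23 : ℕ) : 𝓞 (IntermediateField.adjoin ℚ {θ})), b - ((10 : ℕ) : 𝓞 (IntermediateField.adjoin ℚ {θ}))} : Set _) :=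
      Ideal.subset_span (by simp)
    rw [h] at hmem
    exact absurd (Nat.cast_eq_zero.mp ((Submodule.mem_bot _).mp hmem)) (by norm_num)
  refine classNumberPExp_one_eq_classNumberPExp_zero_of_ambiguous_of_nonNorm_unit (by rw [h3]; decide) κL hκL hs2 hεu hnn
    (exists_ambiguous_of_certificate (by rw [h3]; decide) κL hκL (n := 23) (by norm_num) h0
      (zpowers_mk0_eq_top_d115236n _ h3 b hb h0) (t := 5) (w := 1) (u := 0) (v := 1) (a := 7) (c := -3)
      (by norm_num) (by norm_num) (by norm_num) ?_)
  intro L _ _ _ s hs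
  have hB : (algebraMap _ (𝓞 L) b) ^ 3 + ((-3 : ℤ) : 𝓞 L) * (algebraMap _ (𝓞 L) b) ^ 2 +
      ((0 : ℤ) : 𝓞 L) * (algebraMap _ (𝓞 L) b) + ((-194 : ℤ) : 𝓞 L) = 0 := by
    simpa only [map_add, map_mul, map_pow, map_intCast, map_zero] using
      congrArg (algebraMap (𝓞 (IntermediateField.adjoin ℚ {θ})) (𝓞 L)) hb
  obtain ⟨ω, hω, -⟩ := exists_intElem_of_scaled_cubic _ b (1) (2) (1) (m := 3) (by norm_num) (-6) (-255) (-1452)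
    (by push_cast; linear_combination (((214 : ℤ) : 𝓞 (IntermediateField.adjoin ℚ {θ})) + ((24 : ℤ) : 𝓞 (IntermediateField.adjoin ℚ {θ})) * b + ((9 : ℤ) : 𝓞 (IntermediateField.adjoin ℚ {θ})) * b ^ 2 + ((1 : ℤ) : 𝓞 (IntermediateField.adjoin ℚ {θ})) * b ^ 3) * hb)
  have hΩ : ((3 : ℕ) : 𝓞 L) * algebraMap _ (𝓞 L) ω = ((1 : ℤ) : 𝓞 L) + ((2 : ℤ) : 𝓞 L) * (algebraMap _ (𝓞 L) b) + ((1 : ℤ) : 𝓞 L) * (algebraMap _ (𝓞 L) b) ^ 2 := by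
    simpa only [map_add, map_mul, map_pow, map_intCast, map_natCast] using congrArg (algebraMap _ (𝓞 L)) hω
  obtain ⟨W, hW⟩ := exists_two_mul_eq_of_quadratic (((-1 : ℤ) : 𝓞 L) * (algebraMap _ (𝓞 L) b) * s + ((-1 : ℤ) : 𝓞 L) * (algebraMap _ (𝓞 L) b) ^ 2 * s) ((0 : 𝓞 L)) (((-485 : ℤ) : 𝓞 L) + ((-97 : ℤ) : 𝓞 L) * (algebraMap _ (𝓞 L) b) + ((-8 : ℤ) : 𝓞 L) * (algebraMap _ (𝓞 L) b) ^ 2)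
    (by push_cast; linear_combination (((10 : ℤ) : 𝓞 L) + ((2 : ℤ) : 𝓞 L) * (algebraMap _ (𝓞 L) b)) * hB + (((1 : ℤ) : 𝓞 L) * (algebraMap _ (𝓞 L) b) ^ 2 + ((2 : ℤ) : 𝓞 L) * (algebraMap _ (𝓞 L) b) ^ 3 + ((1 : ℤ) : 𝓞 L) * (algebraMap _ (𝓞 L) b) ^ 4) * hs)
  obtain ⟨y, h1, h2, h3, h4, h5, h6⟩ := capitulationIdentity_d115236n _ s (algebraMap _ (𝓞 L) ω) W hB hs hΩ hW
  rw [map_sub, map_natCast]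
  exact ⟨y, ((23 : ℕ) : 𝓞 L), Nat.cast_ne_zero.mpr (by norm_num), h1, h2, h3, h4, h5, h6⟩

/-- **(A)₂ FOR `460944bn1` MODULO `hLim2` ALONE — no displayed datum left.** The Fukuda-row stamp `conjA_two_460944bn1_of_fukudaLayers` (k4-w1 GEN 5)
with its displayed hypothesis `e₁ = e₀` supplied by `classNumberPExp_one_eq_zero_layer_d115236n` (KERNEL: class-group certificate for `ℚ(θ)`,
capitulation certificate in `ℚ(θ, √2)`, Chevalley's ambiguous class number formula, Fukuda 1994 Thm. 1 (1)). Conditional on `hLim2`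
(Lim 2017 Thm. 3.5 at `2`) BY NAME; BSD is not proved by this. [cite: Lim2017FineSelmer, §3 Thm. 3.5 and Lemma 3.2]
[cite: Fukuda1994, Thm. 1 (1), p. 264] [cite: Lang1990, Ch. 13 §4, Lemma 4.1] -/
theorem conjA_two_460944bn1
    (hLim2 : Lim2017.thm35_at_two_fineSelmerDual_moduleFinite_of_classicalMuVanishes_of_le_divisionField_four)
    {θ : AlgebraicClosure ℚ} (hθ : aeval θ (Cubic.toPoly ⟨1, ((-3 : ℤ) : ℚ), ((0 : ℤ) : ℚ), ((-194 : ℤ) : ℚ)⟩) = 0)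
    (κ : ZpExtension ℚ 2) (hκ : κ.IsCyclotomic) :
    haveI := isElliptic_460944bn1'
    ∃ (γ : absoluteGaloisGroup ℚ) (D : (⟨0, ((0 : ℤ) : ℚ), 0, ((-5770251 : ℤ) : ℚ), ((-5454740502 : ℤ) : ℚ)⟩ : WeierstrassCurve ℚ).FineSelmerDualData κ γ),
      Module.Finite ℤ_[2] (RestrictScalars ℤ_[2] (IwasawaAlgebra 2) D.X) :=
  conjA_two_460944bn1_of_fukudaLayers hLim2 hθ (classNumberPExp_one_eq_zero_layer_d115236n hθ) κ hκ

end Summit.BirchSwinnertonDyer.BirchSwinnertonDyer.Theorems.AddKatoTwo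

end
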